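import Literature.MathematicalPhysics.QuantumLattice.DWaveSource
import Literature.MathematicalPhysics.QuantumLattice.ApproximatingHamiltonianProofs
import Summits.HubbardSuperconductivity.HubbardSuperconductivity.Theorems.BalabanIRBirGroundStateAverageLROSectorCompression
import Summits.HubbardSuperconductivity.HubbardSuperconductivity.Theorems.BalabanIRBirEveryGroundStateThermalChordCore

/-!
# Crux `TwSeededEnsembleEquivalence` (stmt-HubbardSuperconductivity-1698), line `exposed-density-duality`
# (thermal member, skeleton v12) — stub `stub_sectorTraceToolkit` (STUB B: the sector trace toolkit)

Two abstract trace inequalities for a COORDINATE SECTOR of a finite-dimensional Hilbert space `ℂⁿ`,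
i.e. for the `0/1` diagonal projection `P = diagonal 1_p` of a decidable predicate `p` on the index
type (on the Fock space of the torus: `p s := |s| = N`, the `N`-particle sector):

* (B1) the **Jensen trace inequality** `Re Tr (P e^{−βA}) ≤ Σ_o Re Tr (V_oᴴ e^{−βK} V_o)` for a
  Hermitian `K`, a finite Kraus family `V_o` with `Σ_o V_oᴴ V_o = P` and `A = Σ_o V_oᴴ K V_o`
  (`re_trace_proj_gibbsWeight_kraus_le`);
* (B2) **restricted Loewner monotonicity** `e^{−βr} Re Tr (P e^{−βK}) ≤ Re Tr (P e^{−βX})` for a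
  Hermitian `K` commuting with `P`, a Hermitian `X = P X P` with `X ≤ P K P + r P`, and `β ≥ 0`
  (`exp_mul_re_trace_proj_gibbsWeight_le`).

Both are reduced to whole-space statements on the sector `ℂ^{ {i // p i} }` through the COORDINATE
FRAME `B = 1.submatrix id val` (an isometry, `Bᴴ B = 1`, with range projection `B Bᴴ = P`; the
compression `Bᴴ M B` is the block `M|_{p×p}`) and the tree's frame compression of Gibbs weights
(`frame_conjTranspose_gibbsWeight_mul`, `sector_trace_gibbsWeight_eq`: `Tr (P e^{−βM}) = Z(β, BᴴMB)`
when `[M, P] = 0`).  (B2) is then the Loewner antitonicity of `log Z` (`log_partitionFn_le_of_posSemidef`)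
and the scalar shift `Z(H + r) = e^{−βr} Z(H)`.  (B1): `V_o = V_o P` (the `s`-th diagonal entry of
`Σ_o V_oᴴ V_o` is `Σ_{o,t} |V_o t s|²`), so `A = P A P` commutes with `P`; in an orthonormal eigenbasis
`w_i` of the compression `Ã = Bᴴ A B`, `Tr (P e^{−βA}) = Σ_i e^{−β a_i}` with
`a_i = ⟨w_i, Ã w_i⟩ = Σ_o ⟨V_o B w_i, K V_o B w_i⟩` and `Σ_o ‖V_o B w_i‖² = ⟨B w_i, P B w_i⟩ = 1`; the
SPECTRAL JENSEN inequality for a family of vectors (`exp_neg_mul_sum_rayleigh_le`, one application of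
the convexity of `exp` to the joint spectral weights `|(U⋆ V_o B w_i)_k|²` of `K`) gives
`e^{−β a_i} ≤ Σ_o ⟨V_o B w_i, e^{−βK} V_o B w_i⟩`, and summing over `i` (`Σ_i w_i w_iᴴ = 1`, `B Bᴴ = P`,
`V_o P = V_o`) yields `Σ_o Tr (V_oᴴ e^{−βK} V_o)`.

Sources: Peierls–Bogoliubov / Jensen circle of ideas, Bratteli–Robinson II §5.3.1; B. Simon, *The
Statistical Mechanics of Lattice Gases* I (1993) §II.13; F. Hansen, G. K. Pedersen, Jensen's operator
and trace inequalities (2003). Finite-dimensional folklore; no definition is introduced.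

## Mathlib / tree search

REUSED: `sector_trace_gibbsWeight_eq`, `isHermitian_compress` (…`SectorCompression`),
`re_star_dotProduct_conj_diagonal_mulVec`, `star_mul_mul_apply_self` (…`ThermalChordCore`),
`gibbsWeight_eq_conj_diagonal`, `Matrix.IsHermitian.eq_conj_diagonal`, `Matrix.IsHermitian.partitionFn_eq_ofReal`,
`log_partitionFn_le_of_posSemidef`, `log_partitionFn_add_smul_one`, `partitionFn_re_pos`; Mathlib
`Matrix.IsHermitian.eigenvalues_eq`, `Matrix.submatrix_mul`, `Matrix.submatrix_one`,
`Matrix.PosSemidef.conjTranspose_mul_mul_same`, `convexOn_exp.map_sum_le`.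
-/

-- single-problem summit: the module path legitimately repeats `HubbardSuperconductivity` (as in the skeleton)
set_option linter.dupNamespace false

namespace Summit.HubbardSuperconductivity.HubbardSuperconductivity.Theorems.TwSeededEnsembleEquivalence.ThermalDuality

open Matrix Finset Literature.MathematicalPhysics.QuantumLattice
open Summit.HubbardSuperconductivity.HubbardSuperconductivity.Theorems.BirGroundStateAverageLRO.Softmin
open scoped ComplexOrder Matrix.Norms.L2Operator

noncomputable section

section Abstract

variable {n : Type*} [Fintype n] [DecidableEq n]

/-! ### The coordinate frame of a `0/1` diagonal projection -/

/-- The coordinate frame `B = 1.submatrix id val : ℂ^{ {i // p i} } → ℂⁿ` is an isometry,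
`Bᴴ B = 1`. [folklore] -/
theorem coordFrame_conjTranspose_mul_self (p : n → Prop) [DecidablePred p] :
    ((1 : Matrix n n ℂ).submatrix id (Subtype.val : {i // p i} → n))ᴴ *
        (1 : Matrix n n ℂ).submatrix id (Subtype.val : {i // p i} → n) = 1 := by
  rw [conjTranspose_submatrix, conjTranspose_one,
    ← submatrix_mul _ _ _ _ _ Function.bijective_id, Matrix.mul_one,
    submatrix_one _ Subtype.val_injective]

/-- The range projection of the coordinate frame is the diagonal indicator: `B Bᴴ = diagonal 1_p`.
[folklore] -/
theorem coordFrame_mul_conjTranspose (p : n → Prop) [DecidablePred p] :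
    (1 : Matrix n n ℂ).submatrix id (Subtype.val : {i // p i} → n) *
        ((1 : Matrix n n ℂ).submatrix id (Subtype.val : {i // p i} → n))ᴴ =
      diagonal (fun i => if p i then (1 : ℂ) else 0) := by
  rw [conjTranspose_submatrix, conjTranspose_one]
  ext i i'
  simp only [Matrix.mul_apply, submatrix_apply, id, one_apply, diagonal_apply]
  by_cases hi : p i
  · rw [Finset.sum_eq_single (⟨i, hi⟩ : {i // p i})]
    · by_cases hii' : i = i'
      · subst hii'
        simp [hi]
      · simp [hii']
    · intro j _ hj
      have hij : i ≠ j.1 := fun h => hj (Subtype.ext h.symm)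
      rw [if_neg hij, zero_mul]
    · intro h
      exact absurd (Finset.mem_univ _) h
  · rw [Finset.sum_eq_zero fun j _ => ?_]
    · simp [hi]
    · have hij : i ≠ j.1 := fun h => hi (h ▸ j.2)
      rw [if_neg hij, zero_mul]

/-! ### Spectral Jensen for a family of vectors -/

omit [DecidableEq n] in
/-- **Spectral Jensen for a family of vectors.** For a Hermitian `X`, a real `β` and vectors `φ_o`
with `Σ_o ‖φ_o‖² = 1`: `exp (−β Σ_o Re ⟨φ_o, X φ_o⟩) ≤ Σ_o Re ⟨φ_o, e^{−βX} φ_o⟩` (both sides are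
averages over the joint spectral weights `|(U⋆φ_o)_k|²`; convexity of `exp`). The case of one unit
vector is `exp_neg_mul_rayleigh_le_re_gibbsWeight`. B. Simon, *Statistical Mechanics of Lattice
Gases* I §II.13. [folklore] -/
theorem exp_neg_mul_sum_rayleigh_le [DecidableEq n] {ι : Type*} [Fintype ι] {X : Matrix n n ℂ}
    (hX : X.IsHermitian) (β : ℝ) (φ : ι → n → ℂ) (hφ : ∑ o, (star (φ o) ⬝ᵥ φ o).re = 1) :
    Real.exp (-(β * ∑ o, (star (φ o) ⬝ᵥ X *ᵥ φ o).re)) ≤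
      ∑ o, (star (φ o) ⬝ᵥ gibbsWeight β X *ᵥ φ o).re := by
  set U : Matrix n n ℂ := (hX.eigenvectorUnitary : Matrix n n ℂ) with hU
  have hUm : U ∈ unitary (Matrix n n ℂ) := hX.eigenvectorUnitary.prop
  set w : ι → n → ℝ := fun o k => ‖(star U *ᵥ φ o) k‖ ^ 2 with hw
  have hw0 : ∀ o k, 0 ≤ w o k := fun o k => sq_nonneg _
  have hnorm : ∀ o, (star (φ o) ⬝ᵥ φ o).re = ∑ k, w o k := by
    intro o
    have h := re_star_dotProduct_conj_diagonal_mulVec U (fun _ => (1 : ℝ)) (φ o)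
    have h1 : diagonal (fun _ : n => ((1 : ℝ) : ℂ)) = 1 := by simp
    rw [h1, Matrix.mul_one, Unitary.mul_star_self_of_mem hUm, one_mulVec] at h
    simpa using h
  have hw1 : ∑ o, ∑ k, w o k = 1 := by
    rw [← hφ]
    exact Finset.sum_congr rfl fun o _ => (hnorm o).symm
  have hXφ : ∀ o, (star (φ o) ⬝ᵥ X *ᵥ φ o).re = ∑ k, hX.eigenvalues k * w o k := by
    intro o
    conv_lhs => rw [hX.eq_conj_diagonal, ← hU]
    rw [re_star_dotProduct_conj_diagonal_mulVec]
  have hGφ : ∀ o, (star (φ o) ⬝ᵥ gibbsWeight β X *ᵥ φ o).re =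
      ∑ k, Real.exp (-β * hX.eigenvalues k) * w o k := by
    intro o
    rw [gibbsWeight_eq_conj_diagonal hX β, ← hU, re_star_dotProduct_conj_diagonal_mulVec]
  simp_rw [hXφ, hGφ]
  have hJ := (convexOn_exp).map_sum_le (t := (univ : Finset (ι × n))) (w := fun q => w q.1 q.2)
    (p := fun q => -β * hX.eigenvalues q.2) (fun q _ => hw0 q.1 q.2)
    (by rw [Fintype.sum_prod_type]; exact hw1) (fun q _ => Set.mem_univ _)
  simp only [smul_eq_mul] at hJ
  rw [Fintype.sum_prod_type, Fintype.sum_prod_type] at hJ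
  have hlhs : -(β * ∑ o, ∑ k, hX.eigenvalues k * w o k) =
      ∑ o, ∑ k, w o k * (-β * hX.eigenvalues k) := by
    rw [Finset.mul_sum, ← Finset.sum_neg_distrib]
    refine Finset.sum_congr rfl fun o _ => ?_
    rw [Finset.mul_sum, ← Finset.sum_neg_distrib]
    exact Finset.sum_congr rfl fun k _ => by ring
  rw [hlhs]
  refine hJ.trans (le_of_eq ?_)
  exact Finset.sum_congr rfl fun o _ => Finset.sum_congr rfl fun k _ => by ring

/-! ### (B1) The Jensen trace inequality for a Kraus family onto a coordinate sector -/

/-- **Jensen's trace inequality, sector form.** `p` a decidable predicate with diagonal indicator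
`P = diagonal 1_p`, `K` Hermitian, `V_o` a finite Kraus family with `Σ_o V_oᴴ V_o = P`, and
`A = Σ_o V_oᴴ K V_o`. Then `Re Tr (P e^{−βA}) ≤ Σ_o Re Tr (V_oᴴ e^{−βK} V_o)` (Hansen–Pedersen's trace
Jensen inequality for the convex function `x ↦ e^{−βx}`, finite-dimensional case; proof by an
eigenbasis of the compression `Bᴴ A B` to the sector and `exp_neg_mul_sum_rayleigh_le`).
Bratteli–Robinson II §5.3.1. [folklore] -/
theorem re_trace_proj_gibbsWeight_kraus_le (p : n → Prop) [DecidablePred p] {ι : Type*} [Fintype ι]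
    {K : Matrix n n ℂ} (hK : K.IsHermitian) (V : ι → Matrix n n ℂ) (β : ℝ)
    (hV : ∑ o, (V o)ᴴ * V o = diagonal (fun i => if p i then (1 : ℂ) else 0)) :
    ((diagonal (fun i => if p i then (1 : ℂ) else 0) *
        gibbsWeight β (∑ o, (V o)ᴴ * K * V o)).trace).re ≤
      ∑ o, (((V o)ᴴ * gibbsWeight β K * V o).trace).re := by
  set P : Matrix n n ℂ := diagonal (fun i => if p i then (1 : ℂ) else 0) with hPdef
  set B : Matrix n {i // p i} ℂ := (1 : Matrix n n ℂ).submatrix id Subtype.val with hBdef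
  set A : Matrix n n ℂ := ∑ o, (V o)ᴴ * K * V o with hAdef
  have hBB : Bᴴ * B = 1 := coordFrame_conjTranspose_mul_self p
  have hP : B * Bᴴ = P := coordFrame_mul_conjTranspose p
  have hPh : Pᴴ = P := by rw [← hP, conjTranspose_mul, conjTranspose_conjTranspose]
  -- (1) the Kraus operators are supported on the sector: `V o = V o P`
  have hVzero : ∀ o t s, ¬p s → V o t s = 0 := by
    intro o t s hs
    have h := congr_fun (congr_fun hV s) s
    rw [hPdef, diagonal_apply_eq, if_neg hs, Matrix.sum_apply] at h
    simp only [Matrix.mul_apply, conjTranspose_apply, Complex.star_def,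
      ← Complex.normSq_eq_conj_mul_self] at h
    have h' : ∑ o, ∑ t, Complex.normSq (V o t s) = 0 := by exact_mod_cast h
    have h'' := (Finset.sum_eq_zero_iff_of_nonneg (fun o _ =>
      Finset.sum_nonneg fun t _ => Complex.normSq_nonneg _)).1 h' o (Finset.mem_univ _)
    exact Complex.normSq_eq_zero.1 ((Finset.sum_eq_zero_iff_of_nonneg
      (fun t _ => Complex.normSq_nonneg _)).1 h'' t (Finset.mem_univ _))
  have hVP : ∀ o, V o * P = V o := by
    intro o
    ext t s
    rw [hPdef, mul_diagonal]
    by_cases hs : p s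
    · rw [if_pos hs, mul_one]
    · rw [if_neg hs, mul_zero, hVzero o t s hs]
  have hPV : ∀ o, P * (V o)ᴴ = (V o)ᴴ := fun o => by
    conv_lhs => rw [← hPh, ← conjTranspose_mul, hVP]
  -- (2) `A` is Hermitian and lives on the sector
  have hA : A.IsHermitian :=
    isSelfAdjoint_sum univ fun o _ => (isHermitian_conjTranspose_mul_mul (V o) hK).isSelfAdjoint
  have hAP : A * P = A := by
    rw [hAdef, Finset.sum_mul]
    exact Finset.sum_congr rfl fun o _ => by rw [Matrix.mul_assoc, hVP]
  have hPA : P * A = A := by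
    rw [hAdef, Finset.mul_sum]
    exact Finset.sum_congr rfl fun o _ => by rw [← Matrix.mul_assoc, ← Matrix.mul_assoc, hPV]
  have hcomm : Commute (B * Bᴴ) A := by
    rw [hP]
    show P * A = A * P
    rw [hPA, hAP]
  -- (3) the sector trace is the partition function of the compression
  have hAt : (Bᴴ * A * B).IsHermitian := isHermitian_compress B hA
  have hLHS : (P * gibbsWeight β A).trace = partitionFn β (Bᴴ * A * B) := by
    rw [← hP]
    exact sector_trace_gibbsWeight_eq hBB hA hcomm β
  rw [hLHS, hAt.partitionFn_eq_ofReal, Complex.ofReal_re]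
  -- (4) sums of Rayleigh quotients over the eigenbasis of the compression are sector traces
  have hsum : ∀ N' : Matrix n n ℂ,
      ∑ i, star (B *ᵥ ⇑(hAt.eigenvectorBasis i)) ⬝ᵥ N' *ᵥ (B *ᵥ ⇑(hAt.eigenvectorBasis i)) =
        (N' * P).trace := by
    intro N'
    set W : Matrix {i // p i} {i // p i} ℂ :=
      (hAt.eigenvectorUnitary : Matrix {i // p i} {i // p i} ℂ) with hW
    have hWu : W ∈ unitary (Matrix {i // p i} {i // p i} ℂ) := hAt.eigenvectorUnitary.prop
    have hcol : ∀ i, (⇑(hAt.eigenvectorBasis i) : {i // p i} → ℂ) = fun j => W j i :=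
      fun i => funext fun j => (IsHermitian.eigenvectorUnitary_apply hAt j i).symm
    calc ∑ i, star (B *ᵥ ⇑(hAt.eigenvectorBasis i)) ⬝ᵥ N' *ᵥ (B *ᵥ ⇑(hAt.eigenvectorBasis i))
        = ∑ i, star ⇑(hAt.eigenvectorBasis i) ⬝ᵥ (Bᴴ * N' * B) *ᵥ ⇑(hAt.eigenvectorBasis i) :=
          Finset.sum_congr rfl fun i _ => by
            rw [← mulVec_mulVec, ← mulVec_mulVec, dotProduct_mulVec _ Bᴴ, ← star_mulVec]
      _ = ∑ i, (star W * (Bᴴ * N' * B) * W) i i :=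
          Finset.sum_congr rfl fun i _ => by rw [star_mul_mul_apply_self, hcol]
      _ = (star W * (Bᴴ * N' * B) * W).trace := rfl
      _ = (Bᴴ * N' * B).trace := by
          rw [Matrix.mul_assoc, trace_mul_comm, Matrix.mul_assoc, Unitary.mul_star_self_of_mem hWu,
            Matrix.mul_one]
      _ = (N' * P).trace := by rw [Matrix.mul_assoc, trace_mul_comm, Matrix.mul_assoc, hP]
  -- (5) termwise: spectral Jensen for the vectors `V o B w_i`
  have hterm : ∀ i, Real.exp (-(β * hAt.eigenvalues i)) ≤
      ∑ o, (star (V o *ᵥ (B *ᵥ ⇑(hAt.eigenvectorBasis i))) ⬝ᵥ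
        gibbsWeight β K *ᵥ (V o *ᵥ (B *ᵥ ⇑(hAt.eigenvectorBasis i)))).re := by
    intro i
    set w : {i // p i} → ℂ := ⇑(hAt.eigenvectorBasis i) with hw
    have hww : star w ⬝ᵥ w = 1 := by
      rw [dotProduct_comm, ← EuclideanSpace.inner_eq_star_dotProduct, inner_self_eq_norm_sq_to_K,
        hAt.eigenvectorBasis.orthonormal.1 i]
      simp
    have ha : hAt.eigenvalues i =
        ∑ o, (star (V o *ᵥ (B *ᵥ w)) ⬝ᵥ K *ᵥ (V o *ᵥ (B *ᵥ w))).re := by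
      rw [hAt.eigenvalues_eq i, RCLike.re_to_complex, ← hw, ← mulVec_mulVec, ← mulVec_mulVec,
        dotProduct_mulVec _ Bᴴ, ← star_mulVec, hAdef, sum_mulVec, dotProduct_sum, Complex.re_sum]
      refine Finset.sum_congr rfl fun o _ => ?_
      rw [← mulVec_mulVec, ← mulVec_mulVec, dotProduct_mulVec _ (V o)ᴴ, ← star_mulVec]
    have hnorm : ∑ o, (star (V o *ᵥ (B *ᵥ w)) ⬝ᵥ (V o *ᵥ (B *ᵥ w))).re = 1 := by
      have h1 : ∑ o, star (V o *ᵥ (B *ᵥ w)) ⬝ᵥ (V o *ᵥ (B *ᵥ w)) = star w ⬝ᵥ w := by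
        calc ∑ o, star (V o *ᵥ (B *ᵥ w)) ⬝ᵥ (V o *ᵥ (B *ᵥ w))
            = ∑ o, star (B *ᵥ w) ⬝ᵥ ((V o)ᴴ * V o) *ᵥ (B *ᵥ w) :=
              Finset.sum_congr rfl fun o _ => by
                rw [← mulVec_mulVec, dotProduct_mulVec _ (V o)ᴴ, ← star_mulVec]
          _ = star (B *ᵥ w) ⬝ᵥ P *ᵥ (B *ᵥ w) := by rw [← dotProduct_sum, ← sum_mulVec, hV]
          _ = star w ⬝ᵥ (Bᴴ * P * B) *ᵥ w := by
              rw [← mulVec_mulVec, ← mulVec_mulVec, dotProduct_mulVec _ Bᴴ, ← star_mulVec]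
          _ = star w ⬝ᵥ w := by
              rw [← hP]
              simp only [Matrix.mul_assoc, hBB, Matrix.mul_one, one_mulVec]
      rw [← Complex.re_sum, h1, hww, Complex.one_re]
    rw [ha]
    exact exp_neg_mul_sum_rayleigh_le hK β (fun o => V o *ᵥ (B *ᵥ w)) hnorm
  -- (6) sum over the eigenbasis
  calc ∑ i, Real.exp (-(β * hAt.eigenvalues i))
      ≤ ∑ i, ∑ o, (star (V o *ᵥ (B *ᵥ ⇑(hAt.eigenvectorBasis i))) ⬝ᵥ
          gibbsWeight β K *ᵥ (V o *ᵥ (B *ᵥ ⇑(hAt.eigenvectorBasis i)))).re :=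
        Finset.sum_le_sum fun i _ => hterm i
    _ = ∑ o, ∑ i, (star (V o *ᵥ (B *ᵥ ⇑(hAt.eigenvectorBasis i))) ⬝ᵥ
          gibbsWeight β K *ᵥ (V o *ᵥ (B *ᵥ ⇑(hAt.eigenvectorBasis i)))).re := Finset.sum_comm
    _ = ∑ o, (((V o)ᴴ * gibbsWeight β K * V o).trace).re := by
        refine Finset.sum_congr rfl fun o _ => ?_
        rw [← Complex.re_sum]
        have h1 : ∑ i, star (V o *ᵥ (B *ᵥ ⇑(hAt.eigenvectorBasis i))) ⬝ᵥ
            gibbsWeight β K *ᵥ (V o *ᵥ (B *ᵥ ⇑(hAt.eigenvectorBasis i))) =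
            ∑ i, star (B *ᵥ ⇑(hAt.eigenvectorBasis i)) ⬝ᵥ
              ((V o)ᴴ * gibbsWeight β K * V o) *ᵥ (B *ᵥ ⇑(hAt.eigenvectorBasis i)) :=
          Finset.sum_congr rfl fun i _ => by
            rw [← mulVec_mulVec, ← mulVec_mulVec, dotProduct_mulVec _ (V o)ᴴ, ← star_mulVec]
        rw [h1, hsum, Matrix.mul_assoc, hVP]

/-! ### (B2) Restricted Loewner monotonicity of the sector partition function -/

/-- **Restricted Loewner monotonicity.** `p` a decidable predicate with diagonal indicator
`P = diagonal 1_p`, `K` Hermitian with `[K, P] = 0`, `X` Hermitian with `X = P X P` and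
`X ≤ P K P + r P`, `β ≥ 0`. Then `e^{−βr} Re Tr (P e^{−βK}) ≤ Re Tr (P e^{−βX})` (compress to the
sector by the coordinate frame: `Tr (P e^{−βM}) = Z(β, Bᴴ M B)` for `M = K, X`; `log Z` is Loewner
antitone, `log_partitionFn_le_of_posSemidef`; `Z(H + r) = e^{−βr} Z(H)`). Bratteli–Robinson II §5.3.1.
[folklore] -/
theorem exp_mul_re_trace_proj_gibbsWeight_le (p : n → Prop) [DecidablePred p] {K X : Matrix n n ℂ}
    (hK : K.IsHermitian) (hX : X.IsHermitian) (r : ℝ) {β : ℝ} (hβ : 0 ≤ β)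
    (hKP : K * diagonal (fun i => if p i then (1 : ℂ) else 0) =
      diagonal (fun i => if p i then (1 : ℂ) else 0) * K)
    (hXP : X = diagonal (fun i => if p i then (1 : ℂ) else 0) * X *
      diagonal (fun i => if p i then (1 : ℂ) else 0))
    (hpsd : (diagonal (fun i => if p i then (1 : ℂ) else 0) * K *
          diagonal (fun i => if p i then (1 : ℂ) else 0) +
        (r : ℂ) • diagonal (fun i => if p i then (1 : ℂ) else 0) - X).PosSemidef) :
    Real.exp (-(β * r)) *
        ((diagonal (fun i => if p i then (1 : ℂ) else 0) * gibbsWeight β K).trace).re ≤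
      ((diagonal (fun i => if p i then (1 : ℂ) else 0) * gibbsWeight β X).trace).re := by
  set P : Matrix n n ℂ := diagonal (fun i => if p i then (1 : ℂ) else 0) with hPdef
  set B : Matrix n {i // p i} ℂ := (1 : Matrix n n ℂ).submatrix id Subtype.val with hBdef
  have hBB : Bᴴ * B = 1 := coordFrame_conjTranspose_mul_self p
  have hP : B * Bᴴ = P := coordFrame_mul_conjTranspose p
  have hPP : P * P = P := by
    rw [← hP, Matrix.mul_assoc, ← Matrix.mul_assoc Bᴴ, hBB, Matrix.one_mul]
  have hPK : Commute (B * Bᴴ) K := by rw [hP]; exact hKP.symm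
  have hPX' : P * X = X := by rw [hXP, ← Matrix.mul_assoc, ← Matrix.mul_assoc, hPP]
  have hXP' : X * P = X := by rw [hXP, Matrix.mul_assoc, hPP]
  have hPXc : Commute (B * Bᴴ) X := by
    rw [hP]
    show P * X = X * P
    rw [hPX', hXP']
  have h1 : (P * gibbsWeight β K).trace = partitionFn β (Bᴴ * K * B) := by
    rw [← hP]; exact sector_trace_gibbsWeight_eq hBB hK hPK β
  have h2 : (P * gibbsWeight β X).trace = partitionFn β (Bᴴ * X * B) := by
    rw [← hP]; exact sector_trace_gibbsWeight_eq hBB hX hPXc β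
  rw [h1, h2]
  rcases isEmpty_or_nonempty {i // p i} with hk | hk
  · simp only [partitionFn, Matrix.trace_eq_zero_of_isEmpty, Complex.zero_re, mul_zero, le_refl]
  · have hKt : (Bᴴ * K * B).IsHermitian := isHermitian_compress B hK
    have hXt : (Bᴴ * X * B).IsHermitian := isHermitian_compress B hX
    have h1h : (((r : ℝ) : ℂ) • (1 : Matrix {i // p i} {i // p i} ℂ)).IsHermitian := by
      unfold Matrix.IsHermitian
      rw [conjTranspose_smul, conjTranspose_one, Complex.star_def, Complex.conj_ofReal]
    have hKr : (Bᴴ * K * B + (r : ℂ) • 1).IsHermitian := hKt.add h1h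
    have hBP : Bᴴ * P = Bᴴ := by rw [← hP, ← Matrix.mul_assoc, hBB, Matrix.one_mul]
    have hPB : P * B = B := by rw [← hP, Matrix.mul_assoc, hBB, Matrix.mul_one]
    have e1 : Bᴴ * (P * K * P) * B = Bᴴ * K * B := by
      rw [show Bᴴ * (P * K * P) * B = (Bᴴ * P) * K * (P * B) by simp only [Matrix.mul_assoc],
        hBP, hPB]
    have e2 : Bᴴ * P * B = 1 := by rw [hBP, hBB]
    have hdiff : Bᴴ * (P * K * P + (r : ℂ) • P - X) * B =
        Bᴴ * K * B + (r : ℂ) • 1 - Bᴴ * X * B := by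
      rw [Matrix.mul_sub, Matrix.sub_mul, Matrix.mul_add, Matrix.add_mul, Matrix.mul_smul,
        Matrix.smul_mul, e1, e2]
    have hpsd' : (Bᴴ * K * B + (r : ℂ) • 1 - Bᴴ * X * B).PosSemidef := by
      rw [← hdiff]; exact hpsd.conjTranspose_mul_mul_same B
    have hlog := log_partitionFn_le_of_posSemidef hXt hKr hβ hpsd'
    rw [log_partitionFn_add_smul_one hKt β r] at hlog
    have hZK := partitionFn_re_pos hKt β
    have hZX := partitionFn_re_pos hXt β
    have hexp := Real.exp_le_exp.mpr hlog
    rw [Real.exp_sub, Real.exp_log hZK, Real.exp_log hZX, div_le_iff₀ (Real.exp_pos _)] at hexp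
    rw [Real.exp_neg, inv_mul_le_iff₀ (Real.exp_pos _), mul_comm]
    exact hexp

end Abstract

/-! ### The registered stub -/

/-- STUB B — SECTOR TRACE TOOLKIT (abstract, on the Fock space of the `L × L` torus; `P_N` = the diagonal indicator of
the `N`-particle sector). (B1) JENSEN TRACE INEQUALITY: for Hermitian `K` and any finite Kraus family `V_o` with
`Σ_o V_oᴴ V_o = P_N`, `Re Tr (P_N e^{−βA}) ≤ Σ_o Re Tr (V_oᴴ e^{−βK} V_o)` where `A = Σ_o V_oᴴ K V_o`
(`re_trace_proj_gibbsWeight_kraus_le`: `V_o = V_o P_N`, so `A = P_N A P_N`; eigenbasis of the compression of `A` to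
the sector; convexity of `exp` over the joint spectral weights of `K` in the vectors `V_o v`). (B2) RESTRICTED
LOEWNER MONOTONICITY: for Hermitian `K` commuting with `P_N`, Hermitian `X = P_N X P_N` with `X ≤ P_N K P_N + r P_N`
and `β ≥ 0`, `e^{−βr} Re Tr (P_N e^{−βK}) ≤ Re Tr (P_N e^{−βX})` (`exp_mul_re_trace_proj_gibbsWeight_le`:
`Tr (P e^{−βM}) = Z(β, M|_{sector})` for `[M, P] = 0`; `Z` is Loewner-antitone, tree `log_partitionFn_le_of_posSemidef`;
`Z(H + r) = e^{−βr} Z(H)`). Bratteli–Robinson II §5.3 (Peierls–Bogoliubov circle of ideas). [folklore] -/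
theorem stub_sectorTraceToolkit :
    ∀ (L : ℕ) [NeZero L],
      (∀ (K : Matrix (Finset (Orb (FermionTorus 2 L))) (Finset (Orb (FermionTorus 2 L))) ℂ)
        (V : Orb (FermionTorus 2 L) → Matrix (Finset (Orb (FermionTorus 2 L))) (Finset (Orb (FermionTorus 2 L))) ℂ)
        (N : ℕ) (β : ℝ), K.IsHermitian →
        ∑ o, (V o)ᴴ * V o =
          Matrix.diagonal (fun s : Finset (Orb (FermionTorus 2 L)) => if s.card = N then (1 : ℂ) else 0) →
        ((Matrix.diagonal (fun s : Finset (Orb (FermionTorus 2 L)) => if s.card = N then (1 : ℂ) else 0) *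
            Matrix.gibbsWeight β (∑ o, (V o)ᴴ * K * V o)).trace).re ≤
          ∑ o, (((V o)ᴴ * Matrix.gibbsWeight β K * V o).trace).re) ∧
      (∀ (K X : Matrix (Finset (Orb (FermionTorus 2 L))) (Finset (Orb (FermionTorus 2 L))) ℂ)
        (N : ℕ) (r β : ℝ), K.IsHermitian → X.IsHermitian → 0 ≤ β →
        K * Matrix.diagonal (fun s : Finset (Orb (FermionTorus 2 L)) => if s.card = N then (1 : ℂ) else 0) =
          Matrix.diagonal (fun s : Finset (Orb (FermionTorus 2 L)) => if s.card = N then (1 : ℂ) else 0) * K →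
        X = Matrix.diagonal (fun s : Finset (Orb (FermionTorus 2 L)) => if s.card = N then (1 : ℂ) else 0) * X *
          Matrix.diagonal (fun s : Finset (Orb (FermionTorus 2 L)) => if s.card = N then (1 : ℂ) else 0) →
        (Matrix.diagonal (fun s : Finset (Orb (FermionTorus 2 L)) => if s.card = N then (1 : ℂ) else 0) * K *
              Matrix.diagonal (fun s : Finset (Orb (FermionTorus 2 L)) => if s.card = N then (1 : ℂ) else 0) +
            (r : ℂ) • Matrix.diagonal (fun s : Finset (Orb (FermionTorus 2 L)) => if s.card = N then (1 : ℂ) else 0) -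
            X).PosSemidef →
        Real.exp (-(β * r)) *
            ((Matrix.diagonal (fun s : Finset (Orb (FermionTorus 2 L)) => if s.card = N then (1 : ℂ) else 0) *
              Matrix.gibbsWeight β K).trace).re ≤
          ((Matrix.diagonal (fun s : Finset (Orb (FermionTorus 2 L)) => if s.card = N then (1 : ℂ) else 0) *
              Matrix.gibbsWeight β X).trace).re) := by
  intro L _
  refine ⟨fun K V N β hK hV => ?_, fun K X N r β hK hX hβ hKP hXP hpsd => ?_⟩
  · exact re_trace_proj_gibbsWeight_kraus_le
      (fun s : Finset (Orb (FermionTorus 2 L)) => s.card = N) hK V β hV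
  · exact exp_mul_re_trace_proj_gibbsWeight_le
      (fun s : Finset (Orb (FermionTorus 2 L)) => s.card = N) hK hX r hβ hKP hXP hpsd

end

end Summit.HubbardSuperconductivity.HubbardSuperconductivity.Theorems.TwSeededEnsembleEquivalence.ThermalDuality
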